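import Summits.AtomisticToContinuum.HydrodynamicLimit.Theorems.CollisionIsometryCLTCollisionalTransferLocalityFmrConst
import Summits.AtomisticToContinuum.HydrodynamicLimit.Theorems.CollisionIsometryCLTCollisionalTransferLocalityBlockStressDominatorConst
import Summits.AtomisticToContinuum.HydrodynamicLimit.Theorems.CollisionIsometryCLTCollisionalTransferLocalityBlockHeatFluxDominatorConst
import Summits.AtomisticToContinuum.HydrodynamicLimit.Theorems.CollisionIsometryCLTCollisionalTransferLocalityKineticIntegrandDominators
import Summits.AtomisticToContinuum.HydrodynamicLimit.Theorems.CollisionIsometryCLTCollisionalTransferLocalityMarkedVirialConst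
import HarnessLib

/-!
# FastMomentRelaxation (9522) and the marked Campbell law [M] AT GLOBAL EQUILIBRIUM — assembly
(line `hemisphere-affine-slaving`, crux `CollisionalTransferLocality`, stmt-AtomisticToContinuum-9518)

Support file (`--supports stmt-AtomisticToContinuum-9518`) of the line lead (gen 1, tenth seat, instance B),
assembling the four files landed by wave B1 (2026-08-17T02:30–03:05Z):

* [KF-dom] `stub_kineticIntegrand_le_dominators` (…KineticIntegrandDominators, p138785): pointwise
  `ΣD² + ‖q‖² ≤ 2A + 4B + ½T + 50B₂` (traceless projection is a Frobenius contraction; `‖m̄‖² ≤ 2ρ̄Ē`);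
* [KS-D'] `stub_blockStressDominatorConst` (…BlockStressDominatorConst, p139286) and [KS-q']
  `stub_blockHeatFluxDominatorConst` (…BlockHeatFluxDominatorConst, p140145): under the homogeneous local
  Gibbs law `G_N = localGibbsLaw σ 1 0 θ N (Φ N)` the expectations `E∫ₓ(A + B)`, `E∫ₓ(T + B₂)` of the
  dominators vanish as `N → ∞` (Gaussian velocity marks given the positions, Rademacher/sign-flip
  cancellation of the cross terms, `‖φ_N‖_∞ ≤ C(N+1)^{3γ}`, `3γ < 1`);
* [KF-int] `stub_fmrConst_of_dominators` (…FmrConst, p139384): lintegral domination + Tonelli along the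
  jointly measurable flow modification + STATIONARITY of `G_N` under every `Φ_s`
  (`map_flow_localGibbsLaw_const`) + Markov;
* [MC0] `stub_markedVirialConst_of_parts` (…MarkedVirialConst, p138605): the backward marked reduction.

Results:
* `fmr_rung0` / `fmrAt_const` / `fastMomentRelaxation_rung0` — **the kinetic closure `FastMomentRelaxation`
  (item stmt-AtomisticToContinuum-9522, the `∀ t` hinge of route StiffCollisionalRelaxation, consumed BY NAME
  by the filed composition of this crux) HOLDS AT GLOBAL EQUILIBRIUM for EVERY hard-sphere flow family**:
  under `G_N`, for every admissible kernel family, horizon `t > 0` and `δ > 0`,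
  `G_N{δ < ∫₀ᵗ∫ₓ Σ_jk D_jk² + ‖q‖²} → 0` — the block traceless kinetic stress and kinetic heat flux vanish
  in `L²ₜ,ₓ` in probability along the dynamics (no hypothesis; `0 < σ ≤ 1/2`).
* `markedVirialE_rung0_of_equilibriumRung` — **the research stub [M]° (marked Campbell law at the
  collisional pressure) AT GLOBAL EQUILIBRIUM**, modulo ONLY the equilibrium rung of the crux
  (`equilibriumRungFlow_unconditional`, registered; file …EquilibriumRungAssembly p136415, all of whose
  inputs are landed): `sup_{τ ≤ t} |M_N(τ) − (Rhs(τ) + Kfun(τ))| → 0` in `G_N`-probability for every flow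
  family, kernel, horizon and smooth tests.
-/

namespace Summit.AtomisticToContinuum.HydrodynamicLimit.Theorems.HemisphereAffineSlaving

open scoped BigOperators Topology Classical ENNReal InnerProductSpace
open Filter Set Function MeasureTheory

noncomputable section

open Literature.MathematicalPhysics.KineticTheory (T3 V3)

/-- **FastMomentRelaxation at global equilibrium (rung 0 of item 9522), kernel form.** For `0 < σ ≤ 1/2`,
`θ > 0`, EVERY hard-sphere flow family `Φ`, every admissible kernel family, `t > 0` and `δ > 0`:
`G_N{z | δ < ∫_{s ∈ [0,t]} ∫ₓ (Σ_jk Dst_jk² + ‖qfl‖²)(Φ_s z, x)} → 0` under the homogeneous local Gibbs law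
`G_N = localGibbsLaw σ 1 0 θ N (Φ N)`. Assembly of [KF-int] with [KS-D'], [KS-q'], [KF-dom]. [folklore] -/
theorem fmr_rung0 : ∀ σ : ℝ, 0 < σ → σ ≤ 1 / 2 → ∀ θ : ℝ, 0 < θ → ∀ (Φ : Flows σ) (γ C : ℝ) (φ : ℕ → T3 → ℝ), 0 < γ → γ ≤ 1 / 15 → AdmissibleKernel γ C φ → ∀ t : ℝ, 0 < t → ∀ δ : ℝ, 0 < δ → Tendsto (fun N : ℕ => Literature.MathematicalPhysics.KineticTheory.localGibbsLaw σ (fun _ => 1) (fun _ => 0) (fun _ => θ) N (Φ N) {z | δ < ∫ s in Icc 0 t, ∫ x, ((∑ j, ∑ k, Dst φ N ((Φ N).flow s z) x j k ^ 2) + ‖qfl φ N ((Φ N).flow s z) x‖ ^ 2)}) atTop (𝓝 0) :=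
  stub_fmrConst_of_dominators stub_blockStressDominatorConst stub_blockHeatFluxDominatorConst
    stub_kineticIntegrand_le_dominators

/-- **`FMRAt` at constant profiles**: the conclusion of item 9522 (`FMRAt σ a₀ θ₀ u₀`, verbatim its tail after
`σ < σ₀ →`) holds at `(a₀, θ₀, u₀) = (1, θ, 0)` for every `0 < σ ≤ 1/2` and `θ > 0` (the crux's `let`-bound
block stress / heat flux are `Dst` / `qfl` definitionally). [folklore] -/
theorem fmrAt_const : ∀ θ : ℝ, 0 < θ → ∀ σ : ℝ, 0 < σ → σ ≤ 1 / 2 → FMRAt σ (fun _ => 1) (fun _ => θ) (fun _ => 0) := by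
  intro θ hθ σ hσ hhalf Φ γ C φ hγ hγ' hadm ρb mb ub D q t ht δ hδ
  exact fmr_rung0 σ hσ hhalf θ hθ Φ γ C φ hγ hγ' hadm t ht δ hδ

/-- **Rung 0 of `FastMomentRelaxation` in the shape of the route item** (`∃ σ₀ > 0, ∀ σ < σ₀, FMRAt …` at the
homogeneous profiles `a₀ ≡ 1`, `θ₀ ≡ θ > 0`, `u₀ ≡ 0`; `σ₀ := 1/2`). [folklore] -/
theorem fastMomentRelaxation_rung0 : ∀ θ : ℝ, 0 < θ → ∃ σ₀ : ℝ, 0 < σ₀ ∧ ∀ σ : ℝ, 0 < σ → σ < σ₀ → FMRAt σ (fun _ => 1) (fun _ => θ) (fun _ => 0) :=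
  fun θ hθ => ⟨1 / 2, by norm_num, fun σ hσ hlt => fmrAt_const θ hθ σ hσ hlt.le⟩

/-- **The research stub [M]° AT GLOBAL EQUILIBRIUM, modulo the equilibrium rung of the crux only.** Given the
equilibrium rung (`∀ θ > 0 ∃ σ₀ ∀ σ < σ₀ ∀ Φ, ConclusionAtFlow σ 1 θ 0 Φ` — the registered helper
`equilibriumRungFlow_unconditional`, …EquilibriumRungAssembly), for every `θ > 0` there is `σ₀ > 0` such that for
`0 < σ < σ₀`, every flow family, `t > 0`, admissible kernel family and smooth tests `(ψ, χ)` on `[0, t]`: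
`sup_{τ ≤ t} |M_N(τ) − (Rhs(τ) + Kfun(τ))| → 0` in probability under the homogeneous law — the flux-form
mark sum of the collisions IS the local collisional-pressure functional `∫₀^τ∫ (eulerW + kinW) p_c(ρ̄, θ̄)`
at equilibrium ([MC0] fed with `fmr_rung0`). [folklore] -/
theorem markedVirialE_rung0_of_equilibriumRung : (∀ θ : ℝ, 0 < θ → ∃ σ₀ : ℝ, 0 < σ₀ ∧ ∀ σ : ℝ, 0 < σ → σ < σ₀ → ∀ Φ : Flows σ, ConclusionAtFlow σ (fun _ => 1) (fun _ => θ) (fun _ => 0) Φ) → ∀ θ : ℝ, 0 < θ → ∃ σ₀ : ℝ, 0 < σ₀ ∧ ∀ σ : ℝ, 0 < σ → σ < σ₀ → ∀ (Φ : Flows σ) (t : ℝ), 0 < t → ∀ (γ C : ℝ) (φ : ℕ → T3 → ℝ), 0 < γ → γ ≤ 1 / 15 → AdmissibleKernel γ C φ → ∀ (ψ : ℝ → T3 → V3) (χ : ℝ → T3 → ℝ), Literature.Analysis.FunctionSpaces.Torus.IsSmoothSpaceTimeOn (Icc 0 t) ψ → Literature.Analysis.FunctionSpaces.Torus.IsSmoothSpaceTimeOn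 (Icc 0 t) χ → ∀ δ : ℝ, 0 < δ → Tendsto (fun N : ℕ => Literature.MathematicalPhysics.KineticTheory.localGibbsLaw σ (fun _ => 1) (fun _ => 0) (fun _ => θ) N (Φ N) {z | ∃ τ ∈ Icc 0 t, δ < |Mfun σ Φ ψ χ N z τ - (Rhs σ Φ φ ψ χ N z τ + Kfun σ Φ φ ψ χ N z τ)|}) atTop (𝓝 0) :=
  fun h => stub_markedVirialConst_of_parts h fmr_rung0

end

end Summit.AtomisticToContinuum.HydrodynamicLimit.Theorems.HemisphereAffineSlaving
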